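import Summits.QuantumFields.YangMills.Theorems.BalabanUVNodesN22WindowSoftTwoPoint

/-!
# NODE N22 (NE9) — THE SOFT-LOCALIZED ROAD, SEQUEL: the windowed `hK` ON THE TORUS OF RECORD WITHOUT A SITE-GEOMETRY OBJECT (transport of
# `B12Decay510Torus.geomT` along ANY site map `e K : Site (F.P K) j → (ℤ∕N_K M)⁴`, inside the proof), the junction from a Σ-shaped per-`K` bound
# (module J29's soft edition), and the canonical site map when `sitesPerDir j = N_K·M`

Cell `pub-ymgap`, Track A (HUMAN RULING D-0062), WIDTH SEAT `dag-n22-w2` (g2) on node n22 = NE9; `--kind proof --supports stmt-QuantumFields-20544 --as helper`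
(K3⁷ `SpineGivenEndpointR13SepCoPH`), COUNT-NEUTRAL; THEOREMS ONLY (0 `def`, 0 `sorry`, standard axioms).  Sequel of `…N22WindowSoftTwoPoint` (this seat): there §5 keeps
the site geometries `G K` on def-B's sites `Site (F.P K) j` as a PARAMETER with K-uniform leaves (a transport of the torus model `B12Decay510Torus.geomT` to those sites,
as a named object, would be definer business).  THIS FILE removes the parameter WITHOUT declaring an object: for ANY family of site maps
`e K : Site (F.P K) j → TPt 4 (N K * M)` (the consumer's identification of def-B's level-`j` sites with the periodic lattice of `N_K` cubes of side `M` per direction —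
of record `N_K = Sect2.domCount (F.P K) M j`, the cube count of def-T's catalogue `Sect2.domSys`), the pulled-back geometry is assembled INSIDE THE PROOF from `geomT`'s
fields and its leaves are `geomLeafT ∕ cubeSumLeafT ∕ treeLeafT` read at `e K x`; what remains displayed is ONE line about the map — the window compatibility
`hiso : ∀ᶠ K, |z|₁ − c₂ ≤ |e K (site z) − e K (site 0)|_{per,1}` — which §3 DISCHARGES (with `c₂ = 0`) for the canonical map `ZMod.cast` whenever the moduli are compatible
for all large `K`, `N K * M ∣ (F.P K).sitesPerDir j` and `N K * M → ∞` (of record: `2L^{m+K−j}` unit-lattice sites = `N_K` cubes × `M` sites, [I] p. 257, for `K ≥ j + m′ − m`).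

WHAT.  §1 (generic pull-back, any `G₀ K : SiteGeometry (C K) (T₀ K)` and maps `e K : Site (F.P K) j → T₀ K`): ★ `eventually_abs_polWindow_sum_sub_le_comap` (§5 of the parent
file with the geometry PULLED BACK along `e K` — leaves of `G₀ K` in a distance `dist₀ K` on `T₀ K` suffice; per-term soft bounds read at `e K (site z)`, `e K (site 0)`).
§2 (THE TORUS OF RECORD, no geometry parameter): ★★ `eventually_abs_polWindow_sum_sub_le_torusMap` — sites read on `(ℤ∕N_K M)⁴` through `e K`, per-term soft colour-diagonal
kernel-difference bounds `C_E·w·e^{−κ d_j(X̄)}·e^{−δ₀ dist(e site z, X̄)}·e^{−δ₀ dist(e site 0, X̄)}` (`dist` = `distCT` to the nearest cube `nearT`), `δ₀ > 0`, `κ∕2 ≥ κ₀(64, 8)`,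
`hiso` ⇒ `∀ᶠ K, |Δ polWindow| ≤ C_E e^{12Mδ₁} K₀(64,8) K₁(4,δ₀∕2) e^{δ₁c₂} · w · e^{−δ₁|z|₁}`, `δ₁ = ½min{δ₀, κ(4M)⁻¹}`; and its `hK`-literal form
`eventually_abs_polWindow_sum_sub_le_torusMap_hK` (moduli `C·Λ`).  §3 (the canonical site map `ZMod.cast`): `castSite_siteOfInt` (under `N K * M ∣ sitesPerDir j`, the cast sends def-B's window site of `z` to `proj (N K * M) z`),
`tendsto_mul_of_sitesPerDir_eventuallyEq`, ★ `hiso_cast` (`∀ᶠ K, pl1 (cast (site z) − cast (site 0)) = |z|₁` when the divisibility holds eventually and `N K * M → ∞`),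
★★ `eventually_abs_polWindow_sum_sub_le_torusCast` (no geometry parameter, no compatibility hypothesis).
§4 (junction from a Σ-shaped bound, the output of module J29's soft edition `abs_polWindow_localizedSum_sub_le_soft`): `le_softSum_resum` (anything `≤ Σ_X a X` with
`a X ≤` soft weight is `≤ C_E e^{δ₁Mc₁}K₀K₁e^{−δ₁dist}`), ★ `eventually_abs_sub_le_of_softSum` (per-`K` Σ-bounds with K-uniform soft majorants + `hdist` ⇒ the `hK` shape).
§5 (VALUE twins, eventually in `K` — the `∀ᶠ K, |polWindow| ≤ C₀e^{−κ|z|₁}` input of the windowed ⇒ (D4) `KernelDecay` files): ★ `eventually_abs_polWindow_sum_le_comap`,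
★★ `eventually_abs_polWindow_sum_le_torusCast`.

HONEST FRAMING (binding).  Count-neutral kernel bookkeeping; the per-term soft bounds (term-level NE9 × minimizer tails, [I] p. 282 ∕ (4.35)) and the identification
`e K` of def-B's sites with the cube lattice of def-T's catalogue are DISPLAYED (hypotheses ∕ parameters); nothing of Bałaban's asserted; N22 NOT discharged (typed 28∕28 ·
discharged 5∕27 UNCHANGED); K3⁷ OPEN, not claimed; no count claim (the chair's single count line is the only count); one finite 𝕋⁴ programme at fixed ε — R4 closes the
CONDITIONAL rung `BalabanLadder.UV` only; NOTHING about the continuum limit, ℝ⁴, OS axioms, a mass gap or the Clay problem is proved or claimed.  References (TYPES only):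
[I] = Bałaban, CMP 109 (1987) p. 257 (cubes π_j), (1.20)–(1.21) p. 264, p. 282, (5.10) p. 293.
-/

noncomputable section

open Filter Topology
open scoped BigOperators

namespace YMDAG.N22.WindowSoftTwoPoint

open Literature.MathematicalPhysics.QuantumFieldTheory.Balaban1983to89
open Literature.MathematicalPhysics.QuantumFieldTheory.Balaban1983to89.T4Continuum (T4Family)
open Literature.MathematicalPhysics.QuantumFieldTheory.Balaban1983to89.B12PolarizationTensor120 (polComp expChart)
open Literature.MathematicalPhysics.QuantumFieldTheory.Balaban1983to89.Node00 (polScalar polWindow siteOfInt)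
open Literature.MathematicalPhysics.QuantumFieldTheory.Balaban1983to89.B12Decay510
  (SiteGeometry GeomLeaf CubeSumLeaf TreeLeaf delta1 delta1_nonneg delta1_le_half delta1_mul_le)
open Literature.MathematicalPhysics.QuantumFieldTheory.Balaban1983to89.B12Decay510Window (K₁)
open Literature.MathematicalPhysics.QuantumFieldTheory.Balaban1983to89.B12Decay510Torus
  (pl1 geomT geomLeafT cubeSumLeafT treeLeafT distCT nearT pl1_proj_eq_l1 proj_sub)
open Literature.MathematicalPhysics.QuantumFieldTheory.Balaban1983to89.B12TreeDecay (K₀ kappa₀ K₀_pos kappa₀_nonneg)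
open Literature.MathematicalPhysics.QuantumFieldTheory.Balaban1983to89.TreeLengthTorus (TPt TDom tsys tcubeSys torusTreeLen proj)
open Literature.MathematicalPhysics.QuantumFieldTheory.Balaban1983to89.B12Sec2to5 (l1)

variable {𝔄 : Type*} [NormedRing 𝔄] [NormedAlgebra ℝ 𝔄] {V : Type*} [NormedAddCommGroup V] [NormedSpace ℝ V] {ι : Type*} [Fintype ι]
variable (F : T4Family) (j : ℕ)

/-! ## §1 Generic pull-back of a site geometry along site maps `e K` (assembled inside the proof; no object declared) -/

/-- ★ **§5 OF THE PARENT FILE WITH THE GEOMETRY PULLED BACK ALONG SITE MAPS.**  For every `K` a site geometry `G₀ K` over the catalogue `S K` ∕ cover `C K` on SOME site type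
`T₀ K` with the three leaves (K-UNIFORM constants) in a distance `dist₀ K`, and ANY map `e K : Site (F.P K) j → T₀ K`; per-term soft colour-diagonal kernel-difference bounds at
def-B's window sites, the tails read at `e K (site z)`, `e K (site 0)`; the pulled-back distance dominating `|z|₁ − c₂` at the window sites eventually ⇒ for all large `K`,
`|Π^{(K)}(g; z) − Π^{(K)}(g′; z)| ≤ C_E e^{δ₁Mc₁} K₀ K₁ e^{δ₁c₂} · w · e^{−δ₁|z|₁}`.  (The pulled-back `SiteGeometry` is the anonymous structure with fields `G₀.• (e K x)`.) -/
theorem eventually_abs_polWindow_sum_sub_le_comap (S : ℕ → LocDomainSys) (C : (K : ℕ) → B12.CubeCover (S K)) (T₀ : ℕ → Type*)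
    (G₀ : (K : ℕ) → SiteGeometry (C K) (T₀ K)) (dist₀ : (K : ℕ) → T₀ K → T₀ K → ℝ) (e : (K : ℕ) → Site (F.P K) j → T₀ K)
    (ℰ ℰ' : (K : ℕ) → (S K).Dom → (Fin (F.P K).d → Site (F.P K) j → 𝔄) → ℝ) (ρ : V →L[ℝ] 𝔄) (bV : Module.Basis ι ℝ V)
    (hℰ : ∀ K X, ContDiffAt ℝ 2 (expChart (ℰ K X) ρ) 0) (hℰ' : ∀ K X, ContDiffAt ℝ 2 (expChart (ℰ' K X) ρ) 0)
    {CE w κ δ₀ δ₁ M c₁ c₂ K0 K1 : ℝ} (hCE : 0 ≤ CE) (hw : 0 ≤ w) (hK0 : 0 ≤ K0)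
    (hδ₁ : 0 ≤ δ₁) (hδ₁δ₀ : δ₁ ≤ δ₀ / 2) (hδ₁κ : δ₁ * M ≤ κ / 2)
    (hgeo : ∀ K, GeomLeaf (G₀ K) (dist₀ K) M c₁) (hcube : ∀ K, CubeSumLeaf (G₀ K) (δ₀ / 2) K1) (htree : ∀ K, TreeLeaf (C K) (κ / 2) K0)
    (μ ν : Fin 4) (z : Fin 4 → ℤ)
    (hdist : ∀ᶠ K in atTop, l1 z - c₂ ≤ dist₀ K (e K (siteOfInt F K j z)) (e K (siteOfInt F K j 0)))
    (hterm : ∀ (K : ℕ) (X : (S K).Dom) (c : ι),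
      |polComp ℝ (expChart (ℰ K X) ρ) bV (Fin.cast (F.P_d K).symm μ) (siteOfInt F K j z) c (Fin.cast (F.P_d K).symm ν) (siteOfInt F K j 0) c -
          polComp ℝ (expChart (ℰ' K X) ρ) bV (Fin.cast (F.P_d K).symm μ) (siteOfInt F K j z) c (Fin.cast (F.P_d K).symm ν) (siteOfInt F K j 0) c| ≤
        CE * w * Real.exp (-κ * (S K).dj X) * Real.exp (-δ₀ * (G₀ K).distD (e K (siteOfInt F K j z)) X) *
          Real.exp (-δ₀ * (G₀ K).distD (e K (siteOfInt F K j 0)) X)) :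
    ∀ᶠ K in atTop,
      |polWindow F K j (fun U => ∑ X, ℰ K X U) ρ bV μ ν z - polWindow F K j (fun U => ∑ X, ℰ' K X U) ρ bV μ ν z| ≤
        CE * Real.exp (δ₁ * M * c₁) * K0 * K1 * Real.exp (δ₁ * c₂) * w * Real.exp (-(δ₁ * l1 z)) :=
  eventually_abs_polWindow_sum_sub_le F j S C
    (fun K =>
      { distC := fun x c => (G₀ K).distC (e K x) c
        distD := fun x X => (G₀ K).distD (e K x) X
        distC_nonneg := fun x c => (G₀ K).distC_nonneg (e K x) c
        distD_nonneg := fun x X => (G₀ K).distD_nonneg (e K x) X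
        pick := fun x X => (G₀ K).pick (e K x) X
        pick_mem := fun x X => (G₀ K).pick_mem (e K x) X
        distC_pick_le := fun x X => (G₀ K).distC_pick_le (e K x) X })
    (fun K x y => dist₀ K (e K x) (e K y)) ℰ ℰ' ρ bV hℰ hℰ' hCE hw hK0 hδ₁ hδ₁δ₀ hδ₁κ (fun K X x y => hgeo K X (e K x) (e K y))
    (fun K x => hcube K (e K x)) htree μ ν z hdist hterm

/-! ## §2 The torus of record, no geometry parameter: sites read on `(ℤ∕N_K M)⁴` through ANY maps `e K` -/

/-- ★★ **THE WINDOWED `hK` ON THE TORUS OF RECORD, NO SITE-GEOMETRY PARAMETER.**  Data: cube counts `N K` (of record `Sect2.domCount (F.P K) M j`) and cube side `M` (level-`j`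
units); terms `ℰ K X̄`, `ℰ' K X̄` over the torus catalogue `TDom 4 (N K)` (= def-T's `Sect2.domSys`, `d_j = torusTreeLen`); ANY site maps `e K : Site (F.P K) j → TPt 4 (N K * M)` with the
window compatibility `hiso`; per-term soft colour-diagonal kernel-difference bounds with K-free `(C_E·w, κ, δ₀)`, the tails being the periodic ℓ¹ distances from `e K (site z)`,
`e K (site 0)` to the nearest cube of `X̄`; `δ₀ > 0`, `κ∕2 ≥ κ₀(4·2⁴, 8)`.  THEN for all large `K`
`|Π^{(K)}(g; z) − Π^{(K)}(g′; z)| ≤ C_E e^{3·4M·δ₁} K₀(64,8) K₁(4,δ₀∕2) e^{δ₁c₂} · w · e^{−δ₁|z|₁}`, `δ₁ = ½min{δ₀, κ(4M)⁻¹}` — every geometric leaf a THEOREM of `B12Decay510Torus`. -/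
theorem eventually_abs_polWindow_sum_sub_le_torusMap (N : ℕ → ℕ) (M : ℕ) [∀ K, NeZero (N K)] [NeZero M]
    (e : (K : ℕ) → Site (F.P K) j → TPt 4 (N K * M))
    (ℰ ℰ' : (K : ℕ) → TDom 4 (N K) → (Fin (F.P K).d → Site (F.P K) j → 𝔄) → ℝ) (ρ : V →L[ℝ] 𝔄) (bV : Module.Basis ι ℝ V)
    (hℰ : ∀ K X, ContDiffAt ℝ 2 (expChart (ℰ K X) ρ) 0) (hℰ' : ∀ K X, ContDiffAt ℝ 2 (expChart (ℰ' K X) ρ) 0)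
    {CE w κ δ₀ c₂ : ℝ} (hCE : 0 ≤ CE) (hw : 0 ≤ w) (hδ₀ : 0 < δ₀) (hκ : kappa₀ (4 * 2 ^ 4) (2 * 4) ≤ κ / 2)
    (μ ν : Fin 4) (z : Fin 4 → ℤ)
    (hiso : ∀ᶠ K in atTop, l1 z - c₂ ≤ pl1 (e K (siteOfInt F K j z) - e K (siteOfInt F K j 0)))
    (hterm : ∀ (K : ℕ) (X : TDom 4 (N K)) (c : ι),
      |polComp ℝ (expChart (ℰ K X) ρ) bV (Fin.cast (F.P_d K).symm μ) (siteOfInt F K j z) c (Fin.cast (F.P_d K).symm ν) (siteOfInt F K j 0) c -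
          polComp ℝ (expChart (ℰ' K X) ρ) bV (Fin.cast (F.P_d K).symm μ) (siteOfInt F K j z) c (Fin.cast (F.P_d K).symm ν) (siteOfInt F K j 0) c| ≤
        CE * w * Real.exp (-κ * torusTreeLen X.1) * Real.exp (-δ₀ * distCT (N K) M (e K (siteOfInt F K j z)) (nearT (M := M) (e K (siteOfInt F K j z)) X)) *
          Real.exp (-δ₀ * distCT (N K) M (e K (siteOfInt F K j 0)) (nearT (M := M) (e K (siteOfInt F K j 0)) X))) :
    ∀ᶠ K in atTop,
      |polWindow F K j (fun U => ∑ X, ℰ K X U) ρ bV μ ν z - polWindow F K j (fun U => ∑ X, ℰ' K X U) ρ bV μ ν z| ≤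
        CE * Real.exp (delta1 δ₀ κ ((M : ℝ) * 4) * ((M : ℝ) * 4) * 3) * K₀ (4 * 2 ^ 4) (2 * 4) * K₁ 4 (δ₀ / 2) *
          Real.exp (delta1 δ₀ κ ((M : ℝ) * 4) * c₂) * w * Real.exp (-(delta1 δ₀ κ ((M : ℝ) * 4) * l1 z)) := by
  have hκ0 : 0 ≤ κ := by
    have h2 : (0 : ℝ) ≤ κ / 2 := (kappa₀_nonneg (c₀ := 4 * 2 ^ 4) (by positivity) (2 * 4)).trans hκ
    linarith
  have hMd : (0 : ℝ) < (M : ℝ) * 4 := mul_pos (Nat.cast_pos.2 (Nat.pos_of_neZero M)) (by norm_num)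
  have h := eventually_abs_polWindow_sum_sub_le_comap F j (fun K => tsys 4 (N K)) (fun K => (tcubeSys 4 (N K)).toCubeCover)
    (fun K => TPt 4 (N K * M)) (fun K => geomT 4 (N K) M) (fun K x y => pl1 (x - y)) e ℰ ℰ' ρ bV hℰ hℰ' hCE hw (K₀_pos _ _).le
    (delta1_nonneg hδ₀.le hκ0 hMd) (delta1_le_half δ₀ κ _) (delta1_mul_le δ₀ κ hMd)
    (fun K => by simpa using geomLeafT 4 (N K) M) (fun K => cubeSumLeafT 4 (N K) M (half_pos hδ₀)) (fun K => treeLeafT 4 (N K) hκ) μ ν z hiso hterm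
  exact h

/-- ★★ **… IN dag-n22-w3's `hK` SHAPE** (history modulus `w := Σ_{i<k+1} Λ_{k+1,i}|g_i − g′_i|`, moduli `C·Λ` with
`C = C_E e^{12Mδ₁} K₀(64,8) K₁(4,δ₀∕2) e^{δ₁c₂}`): `∀ᶠ K, |Π^{(K)}(g; z) − Π^{(K)}(g′; z)| ≤ e^{−δ₁|z|₁} · Σ_{i<k+1} (C·Λ_{k+1,i})|g_i − g′_i|`. -/
theorem eventually_abs_polWindow_sum_sub_le_torusMap_hK (N : ℕ → ℕ) (M : ℕ) [∀ K, NeZero (N K)] [NeZero M]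
    (e : (K : ℕ) → Site (F.P K) j → TPt 4 (N K * M))
    (ℰ ℰ' : (K : ℕ) → TDom 4 (N K) → (Fin (F.P K).d → Site (F.P K) j → 𝔄) → ℝ) (ρ : V →L[ℝ] 𝔄) (bV : Module.Basis ι ℝ V)
    (hℰ : ∀ K X, ContDiffAt ℝ 2 (expChart (ℰ K X) ρ) 0) (hℰ' : ∀ K X, ContDiffAt ℝ 2 (expChart (ℰ' K X) ρ) 0)
    {CE κ δ₀ c₂ : ℝ} (Λm : ℕ → ℕ → ℝ) (g g' : ℕ → ℝ) (k : ℕ) (hΛ : ∀ i, 0 ≤ Λm (k + 1) i)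
    (hCE : 0 ≤ CE) (hδ₀ : 0 < δ₀) (hκ : kappa₀ (4 * 2 ^ 4) (2 * 4) ≤ κ / 2)
    (μ ν : Fin 4) (z : Fin 4 → ℤ)
    (hiso : ∀ᶠ K in atTop, l1 z - c₂ ≤ pl1 (e K (siteOfInt F K j z) - e K (siteOfInt F K j 0)))
    (hterm : ∀ (K : ℕ) (X : TDom 4 (N K)) (c : ι),
      |polComp ℝ (expChart (ℰ K X) ρ) bV (Fin.cast (F.P_d K).symm μ) (siteOfInt F K j z) c (Fin.cast (F.P_d K).symm ν) (siteOfInt F K j 0) c -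
          polComp ℝ (expChart (ℰ' K X) ρ) bV (Fin.cast (F.P_d K).symm μ) (siteOfInt F K j z) c (Fin.cast (F.P_d K).symm ν) (siteOfInt F K j 0) c| ≤
        CE * (∑ i ∈ Finset.range (k + 1), Λm (k + 1) i * |g i - g' i|) * Real.exp (-κ * torusTreeLen X.1) *
          Real.exp (-δ₀ * distCT (N K) M (e K (siteOfInt F K j z)) (nearT (M := M) (e K (siteOfInt F K j z)) X)) *
          Real.exp (-δ₀ * distCT (N K) M (e K (siteOfInt F K j 0)) (nearT (M := M) (e K (siteOfInt F K j 0)) X))) :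
    ∀ᶠ K in atTop,
      |polWindow F K j (fun U => ∑ X, ℰ K X U) ρ bV μ ν z - polWindow F K j (fun U => ∑ X, ℰ' K X U) ρ bV μ ν z| ≤
        Real.exp (-(delta1 δ₀ κ ((M : ℝ) * 4) * l1 z)) * ∑ i ∈ Finset.range (k + 1),
          (CE * Real.exp (delta1 δ₀ κ ((M : ℝ) * 4) * ((M : ℝ) * 4) * 3) * K₀ (4 * 2 ^ 4) (2 * 4) * K₁ 4 (δ₀ / 2) *
            Real.exp (delta1 δ₀ κ ((M : ℝ) * 4) * c₂) * Λm (k + 1) i) * |g i - g' i| := by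
  have hw : 0 ≤ ∑ i ∈ Finset.range (k + 1), Λm (k + 1) i * |g i - g' i| :=
    Finset.sum_nonneg fun i _ => mul_nonneg (hΛ i) (abs_nonneg _)
  have h := eventually_abs_polWindow_sum_sub_le_torusMap F j N M e ℰ ℰ' ρ bV hℰ hℰ' hCE hw hδ₀ hκ μ ν z hiso hterm
  filter_upwards [h] with K hK
  rw [← const_mul_historyModulus]
  exact hK

/-! ## §3 The canonical site map `ZMod.cast` when the moduli eventually agree: `N_K · M ∣ sitesPerDir j` -/

/-- When `N K * M ∣ (F.P K).sitesPerDir j` (of record an EQUALITY for all large `K`: `2L^{m+K−j}` unit-lattice sites per direction = `N_K` cubes of side `M`, [I] p. 257),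
the canonical map `ZMod.cast : ℤ∕(sitesPerDir j) → ℤ∕(N_K M)` sends def-B's window site of `z` to the covering projection `proj (N K * M)` of `z` (coordinatewise
`ZMod.cast_intCast`). -/
theorem castSite_siteOfInt (N : ℕ → ℕ) (M : ℕ) (K : ℕ) (h : N K * M ∣ (F.P K).sitesPerDir j) (z : Fin 4 → ℤ) :
    (fun i : Fin (F.P K).d => (ZMod.cast (siteOfInt F K j z i) : ZMod (N K * M))) = proj (N K * M) (fun i => z (Fin.cast (F.P_d K) i)) := by
  funext i
  simp only [siteOfInt, proj]
  exact ZMod.cast_intCast h _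

/-- If the moduli agree for all large `K` then `N K * M → ∞` along the family (it IS `2L^{m+K−j}` eventually). -/
theorem tendsto_mul_of_sitesPerDir_eventuallyEq (N : ℕ → ℕ) (M : ℕ) (h : ∀ᶠ K in atTop, (F.P K).sitesPerDir j = N K * M) :
    Tendsto (fun K => N K * M) atTop atTop :=
  (sitesPerDir_level_tendsto F j).congr' h

/-- ★ **THE WINDOW COMPATIBILITY OF THE CANONICAL SITE MAP** (`hiso` of §2 with `c₂ = 0`, as an equality): if `N K * M ∣ sitesPerDir j` for all large `K` and `N K * M → ∞`,
the periodic ℓ¹ distance between the cast window sites of `z` and `0` on `(ℤ∕N_K M)⁴` is `|z|₁` for all large `K`. -/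
theorem hiso_cast (N : ℕ → ℕ) (M : ℕ) [∀ K, NeZero (N K)] [NeZero M] (hdvd : ∀ᶠ K in atTop, N K * M ∣ (F.P K).sitesPerDir j)
    (hN : Tendsto (fun K => N K * M) atTop atTop) (z : Fin 4 → ℤ) :
    ∀ᶠ K in atTop,
      pl1 ((fun (x : Site (F.P K) j) (i : Fin (F.P K).d) => (ZMod.cast (x i) : ZMod (N K * M))) (siteOfInt F K j z) -
          (fun (x : Site (F.P K) j) (i : Fin (F.P K).d) => (ZMod.cast (x i) : ZMod (N K * M))) (siteOfInt F K j 0)) = l1 z := by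
  have hB : ∀ i : Fin 4, 2 * |z i| ≤ 2 * ∑ k, |z k| := fun i =>
    mul_le_mul_of_nonneg_left (Finset.single_le_sum (fun k _ => abs_nonneg (z k)) (Finset.mem_univ i)) (by norm_num)
  filter_upwards [hN.eventually_gt_atTop (2 * ∑ k, |z k|).toNat, hdvd] with K hK hKd
  have hlt : ∀ i : Fin (F.P K).d, 2 * |(fun i => z (Fin.cast (F.P_d K) i)) i| < ((N K * M : ℕ) : ℤ) := by
    intro i
    have h1 : 2 * ∑ k, |z k| < ((N K * M : ℕ) : ℤ) := (Int.self_le_toNat _).trans_lt (by exact_mod_cast hK)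
    exact (hB _).trans_lt h1
  show pl1 ((fun i : Fin (F.P K).d => (ZMod.cast (siteOfInt F K j z i) : ZMod (N K * M))) -
      (fun i : Fin (F.P K).d => (ZMod.cast (siteOfInt F K j 0 i) : ZMod (N K * M)))) = l1 z
  rw [castSite_siteOfInt F j N M K hKd z, castSite_siteOfInt F j N M K hKd 0]
  have h0 : proj (N K * M) (fun i : Fin (F.P K).d => (0 : Fin 4 → ℤ) (Fin.cast (F.P_d K) i)) = 0 := by
    funext i; simp [proj]
  rw [h0, sub_zero, pl1_proj_eq_l1 hlt]
  rfl

/-- ★★ **THE TORUS OF RECORD WITH THE CANONICAL SITE MAP** — no geometry parameter, no compatibility hypothesis: `N K * M ∣ sitesPerDir j` for all large `K`, `N K * M → ∞`,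
per-term soft bounds read through `ZMod.cast`, `δ₀ > 0`, `κ∕2 ≥ κ₀(64, 8)` ⇒ `∀ᶠ K, |Π^{(K)}(g; z) − Π^{(K)}(g′; z)| ≤ C_E e^{12Mδ₁} K₀(64,8) K₁(4,δ₀∕2) · w · e^{−δ₁|z|₁}`. -/
theorem eventually_abs_polWindow_sum_sub_le_torusCast (N : ℕ → ℕ) (M : ℕ) [∀ K, NeZero (N K)] [NeZero M]
    (hdvd : ∀ᶠ K in atTop, N K * M ∣ (F.P K).sitesPerDir j) (hN : Tendsto (fun K => N K * M) atTop atTop)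
    (ℰ ℰ' : (K : ℕ) → TDom 4 (N K) → (Fin (F.P K).d → Site (F.P K) j → 𝔄) → ℝ) (ρ : V →L[ℝ] 𝔄) (bV : Module.Basis ι ℝ V)
    (hℰ : ∀ K X, ContDiffAt ℝ 2 (expChart (ℰ K X) ρ) 0) (hℰ' : ∀ K X, ContDiffAt ℝ 2 (expChart (ℰ' K X) ρ) 0)
    {CE w κ δ₀ : ℝ} (hCE : 0 ≤ CE) (hw : 0 ≤ w) (hδ₀ : 0 < δ₀) (hκ : kappa₀ (4 * 2 ^ 4) (2 * 4) ≤ κ / 2)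
    (μ ν : Fin 4) (z : Fin 4 → ℤ)
    (hterm : ∀ (K : ℕ) (X : TDom 4 (N K)) (c : ι),
      let e : Site (F.P K) j → TPt 4 (N K * M) := fun x i => (ZMod.cast (x i) : ZMod (N K * M))
      |polComp ℝ (expChart (ℰ K X) ρ) bV (Fin.cast (F.P_d K).symm μ) (siteOfInt F K j z) c (Fin.cast (F.P_d K).symm ν) (siteOfInt F K j 0) c -
          polComp ℝ (expChart (ℰ' K X) ρ) bV (Fin.cast (F.P_d K).symm μ) (siteOfInt F K j z) c (Fin.cast (F.P_d K).symm ν) (siteOfInt F K j 0) c| ≤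
        CE * w * Real.exp (-κ * torusTreeLen X.1) * Real.exp (-δ₀ * distCT (N K) M (e (siteOfInt F K j z)) (nearT (M := M) (e (siteOfInt F K j z)) X)) *
          Real.exp (-δ₀ * distCT (N K) M (e (siteOfInt F K j 0)) (nearT (M := M) (e (siteOfInt F K j 0)) X))) :
    ∀ᶠ K in atTop,
      |polWindow F K j (fun U => ∑ X, ℰ K X U) ρ bV μ ν z - polWindow F K j (fun U => ∑ X, ℰ' K X U) ρ bV μ ν z| ≤
        CE * Real.exp (delta1 δ₀ κ ((M : ℝ) * 4) * ((M : ℝ) * 4) * 3) * K₀ (4 * 2 ^ 4) (2 * 4) * K₁ 4 (δ₀ / 2) * w *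
          Real.exp (-(delta1 δ₀ κ ((M : ℝ) * 4) * l1 z)) := by
  have hiso : ∀ᶠ K in atTop, l1 z - 0 ≤
      pl1 ((fun (x : Site (F.P K) j) (i : Fin (F.P K).d) => (ZMod.cast (x i) : ZMod (N K * M))) (siteOfInt F K j z) -
        (fun (x : Site (F.P K) j) (i : Fin (F.P K).d) => (ZMod.cast (x i) : ZMod (N K * M))) (siteOfInt F K j 0)) := by
    filter_upwards [hiso_cast F j N M hdvd hN z] with K hK
    rw [sub_zero]
    exact hK.symm.le
  have h' := eventually_abs_polWindow_sum_sub_le_torusMap F j N M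
    (fun K (x : Site (F.P K) j) (i : Fin (F.P K).d) => (ZMod.cast (x i) : ZMod (N K * M))) ℰ ℰ' ρ bV hℰ hℰ' hCE hw hδ₀ hκ μ ν z hiso hterm
  simpa only [mul_zero, Real.exp_zero, mul_one] using h'

/-! ## §4 Junction from a Σ-shaped per-`K` bound (module J29's soft edition) -/

section SoftSum
variable {T : Type*} {S : LocDomainSys} {C : B12.CubeCover S} (G : SiteGeometry C T)

/-- **Resummation of a Σ-shaped bound**: anything `≤ Σ_X a X` whose summands obey the soft majorant `a X ≤ C_E e^{−κ d_j(X)} e^{−δ₀dist(x,X)} e^{−δ₀dist(y,X)}` is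
`≤ C_E e^{δ₁Mc₁} K₀ K₁ e^{−δ₁ dist(x,y)}` under the three leaves (the parent file's `sum_softWeight_le`). -/
theorem le_softSum_resum {t : ℝ} {a : S.Dom → ℝ} {dist : T → T → ℝ} {CE κ δ₀ δ₁ M c₁ K0 K1 : ℝ} (hCE : 0 ≤ CE) (hK0 : 0 ≤ K0)
    (hδ₁ : 0 ≤ δ₁) (hδ₁δ₀ : δ₁ ≤ δ₀ / 2) (hδ₁κ : δ₁ * M ≤ κ / 2)
    (hgeo : GeomLeaf G dist M c₁) (hcube : CubeSumLeaf G (δ₀ / 2) K1) (htree : TreeLeaf C (κ / 2) K0) (x y : T)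
    (ht : t ≤ ∑ X, a X) (ha : ∀ X, a X ≤ CE * Real.exp (-κ * S.dj X) * Real.exp (-δ₀ * G.distD x X) * Real.exp (-δ₀ * G.distD y X)) :
    t ≤ CE * Real.exp (δ₁ * M * c₁) * K0 * K1 * Real.exp (-δ₁ * dist x y) :=
  ht.trans ((Finset.sum_le_sum fun X _ => ha X).trans (sum_softWeight_le G hCE hK0 hδ₁ hδ₁δ₀ hδ₁κ hgeo hcube htree x y))

end SoftSum

/-- ★ **FROM Σ-SHAPED PER-`K` WINDOW BOUNDS TO `hK`**: if for every `K` the windowed history difference is bounded by a SUM over the terms (module J29's soft edition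
`abs_polWindow_localizedSum_sub_le_soft`: `≤ Σ_X 16·M_X·r⁻²·w_X(site z)·w_X(site 0)`) whose summands obey K-uniform soft majorants relative to site geometries `G K` with
K-uniform leaves, and the distances dominate `|z|₁ − c₂` at the window sites eventually, then for all large `K` the difference is `≤ C_E e^{δ₁Mc₁}K₀K₁e^{δ₁c₂}·w·e^{−δ₁|z|₁}`. -/
theorem eventually_abs_sub_le_of_softSum (S : ℕ → LocDomainSys) (C : (K : ℕ) → B12.CubeCover (S K))
    (G : (K : ℕ) → SiteGeometry (C K) (Site (F.P K) j)) (dist : (K : ℕ) → Site (F.P K) j → Site (F.P K) j → ℝ)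
    (Δ : ℕ → ℝ) (a : (K : ℕ) → (S K).Dom → ℝ)
    {CE w κ δ₀ δ₁ M c₁ c₂ K0 K1 : ℝ} (hCE : 0 ≤ CE) (hw : 0 ≤ w) (hK0 : 0 ≤ K0) (hK1 : 0 ≤ K1)
    (hδ₁ : 0 ≤ δ₁) (hδ₁δ₀ : δ₁ ≤ δ₀ / 2) (hδ₁κ : δ₁ * M ≤ κ / 2)
    (hgeo : ∀ K, GeomLeaf (G K) (dist K) M c₁) (hcube : ∀ K, CubeSumLeaf (G K) (δ₀ / 2) K1) (htree : ∀ K, TreeLeaf (C K) (κ / 2) K0)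
    (z : Fin 4 → ℤ) (hdist : ∀ᶠ K in atTop, l1 z - c₂ ≤ dist K (siteOfInt F K j z) (siteOfInt F K j 0))
    (hΔ : ∀ K, Δ K ≤ ∑ X, a K X)
    (ha : ∀ K X, a K X ≤ CE * w * Real.exp (-κ * (S K).dj X) * Real.exp (-δ₀ * (G K).distD (siteOfInt F K j z) X) *
      Real.exp (-δ₀ * (G K).distD (siteOfInt F K j 0) X)) :
    ∀ᶠ K in atTop, Δ K ≤ CE * Real.exp (δ₁ * M * c₁) * K0 * K1 * Real.exp (δ₁ * c₂) * w * Real.exp (-(δ₁ * l1 z)) := by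
  filter_upwards [hdist] with K hK
  have h := le_softSum_resum (G K) (mul_nonneg hCE hw) hK0 hδ₁ hδ₁δ₀ hδ₁κ (hgeo K) (hcube K) (htree K) (siteOfInt F K j z) (siteOfInt F K j 0) (hΔ K) (ha K)
  have hexp : Real.exp (-δ₁ * dist K (siteOfInt F K j z) (siteOfInt F K j 0)) ≤ Real.exp (δ₁ * c₂) * Real.exp (-(δ₁ * l1 z)) := by
    rw [← Real.exp_add]
    exact Real.exp_le_exp.2 (by nlinarith)
  have hc : 0 ≤ CE * w * Real.exp (δ₁ * M * c₁) * K0 * K1 :=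
    mul_nonneg (mul_nonneg (mul_nonneg (mul_nonneg hCE hw) (Real.exp_pos _).le) hK0) hK1
  calc Δ K ≤ CE * w * Real.exp (δ₁ * M * c₁) * K0 * K1 * Real.exp (-δ₁ * dist K (siteOfInt F K j z) (siteOfInt F K j 0)) := h
    _ ≤ CE * w * Real.exp (δ₁ * M * c₁) * K0 * K1 * (Real.exp (δ₁ * c₂) * Real.exp (-(δ₁ * l1 z))) := mul_le_mul_of_nonneg_left hexp hc
    _ = CE * Real.exp (δ₁ * M * c₁) * K0 * K1 * Real.exp (δ₁ * c₂) * w * Real.exp (-(δ₁ * l1 z)) := by ring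

/-! ## §5 VALUE twins, eventually in `K` — the windowed (5.10)-decay input of the (D4) road (`KernelDecay` of the limiting kernels) -/

/-- **THE WINDOWED VALUE BOUND, EVENTUALLY IN `K`, GEOMETRY PULLED BACK ALONG SITE MAPS**: per-term soft colour-diagonal bounds ON THE KERNEL ITSELF at def-B's window sites
(tails read at `e K (site z)`, `e K (site 0)` in geometries `G₀ K` with K-uniform leaves), distances dominating `|z|₁ − c₂` eventually ⇒ for all large `K`,
`|Π^{(K)}(z)| ≤ C_E e^{δ₁Mc₁} K₀ K₁ e^{δ₁c₂} e^{−δ₁|z|₁}` — the `∀ᶠ K, |polWindow …| ≤ C₀ e^{−κ|z|₁}` input of the windowed ⇒ (D4) files (take `e K := id` for a geometry on the sites themselves). -/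
theorem eventually_abs_polWindow_sum_le_comap (S : ℕ → LocDomainSys) (C : (K : ℕ) → B12.CubeCover (S K)) (T₀ : ℕ → Type*)
    (G₀ : (K : ℕ) → SiteGeometry (C K) (T₀ K)) (dist₀ : (K : ℕ) → T₀ K → T₀ K → ℝ) (e : (K : ℕ) → Site (F.P K) j → T₀ K)
    (ℰ : (K : ℕ) → (S K).Dom → (Fin (F.P K).d → Site (F.P K) j → 𝔄) → ℝ) (ρ : V →L[ℝ] 𝔄) (bV : Module.Basis ι ℝ V)
    (hℰ : ∀ K X, ContDiffAt ℝ 2 (expChart (ℰ K X) ρ) 0)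
    {CE κ δ₀ δ₁ M c₁ c₂ K0 K1 : ℝ} (hCE : 0 ≤ CE) (hK0 : 0 ≤ K0)
    (hδ₁ : 0 ≤ δ₁) (hδ₁δ₀ : δ₁ ≤ δ₀ / 2) (hδ₁κ : δ₁ * M ≤ κ / 2)
    (hgeo : ∀ K, GeomLeaf (G₀ K) (dist₀ K) M c₁) (hcube : ∀ K, CubeSumLeaf (G₀ K) (δ₀ / 2) K1) (htree : ∀ K, TreeLeaf (C K) (κ / 2) K0)
    (μ ν : Fin 4) (z : Fin 4 → ℤ)
    (hdist : ∀ᶠ K in atTop, l1 z - c₂ ≤ dist₀ K (e K (siteOfInt F K j z)) (e K (siteOfInt F K j 0)))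
    (hterm : ∀ (K : ℕ) (X : (S K).Dom) (c : ι),
      |polComp ℝ (expChart (ℰ K X) ρ) bV (Fin.cast (F.P_d K).symm μ) (siteOfInt F K j z) c (Fin.cast (F.P_d K).symm ν) (siteOfInt F K j 0) c| ≤
        CE * Real.exp (-κ * (S K).dj X) * Real.exp (-δ₀ * (G₀ K).distD (e K (siteOfInt F K j z)) X) *
          Real.exp (-δ₀ * (G₀ K).distD (e K (siteOfInt F K j 0)) X)) :
    ∀ᶠ K in atTop, |polWindow F K j (fun U => ∑ X, ℰ K X U) ρ bV μ ν z| ≤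
        CE * Real.exp (δ₁ * M * c₁) * K0 * K1 * Real.exp (δ₁ * c₂) * Real.exp (-(δ₁ * l1 z)) := by
  filter_upwards [hdist] with K hK
  have h := abs_polWindow_sum_le_of_softKernelBound F K j
    ({ distC := fun x c => (G₀ K).distC (e K x) c
       distD := fun x X => (G₀ K).distD (e K x) X
       distC_nonneg := fun x c => (G₀ K).distC_nonneg (e K x) c
       distD_nonneg := fun x X => (G₀ K).distD_nonneg (e K x) X
       pick := fun x X => (G₀ K).pick (e K x) X
       pick_mem := fun x X => (G₀ K).pick_mem (e K x) X
       distC_pick_le := fun x X => (G₀ K).distC_pick_le (e K x) X } : SiteGeometry (C K) (Site (F.P K) j))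
    (ℰ K) ρ bV (hℰ K) (dist := fun x y => dist₀ K (e K x) (e K y)) hCE hK0 hδ₁ hδ₁δ₀ hδ₁κ (fun X x y => hgeo K X (e K x) (e K y))
    (fun x => hcube K (e K x)) (htree K) μ ν z (hterm K)
  have hexp : Real.exp (-δ₁ * dist₀ K (e K (siteOfInt F K j z)) (e K (siteOfInt F K j 0))) ≤ Real.exp (δ₁ * c₂) * Real.exp (-(δ₁ * l1 z)) := by
    rw [← Real.exp_add]
    exact Real.exp_le_exp.2 (by nlinarith)
  have hK1 : 0 ≤ K1 := le_trans (Finset.sum_nonneg fun c _ => (Real.exp_pos _).le) ((hcube K) (e K (siteOfInt F K j 0)))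
  have hc : 0 ≤ CE * Real.exp (δ₁ * M * c₁) * K0 * K1 := mul_nonneg (mul_nonneg (mul_nonneg hCE (Real.exp_pos _).le) hK0) hK1
  calc |polWindow F K j (fun U => ∑ X, ℰ K X U) ρ bV μ ν z|
      ≤ CE * Real.exp (δ₁ * M * c₁) * K0 * K1 * Real.exp (-δ₁ * dist₀ K (e K (siteOfInt F K j z)) (e K (siteOfInt F K j 0))) := h
    _ ≤ CE * Real.exp (δ₁ * M * c₁) * K0 * K1 * (Real.exp (δ₁ * c₂) * Real.exp (-(δ₁ * l1 z))) := mul_le_mul_of_nonneg_left hexp hc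
    _ = CE * Real.exp (δ₁ * M * c₁) * K0 * K1 * Real.exp (δ₁ * c₂) * Real.exp (-(δ₁ * l1 z)) := by ring

/-- ★★ **THE WINDOWED VALUE BOUND ON THE TORUS OF RECORD WITH THE CANONICAL SITE MAP** (the (D4) road's input, no geometry parameter): moduli agreeing along the family,
per-term soft bounds on the kernel itself read through `ZMod.cast`, `δ₀ > 0`, `κ∕2 ≥ κ₀(64,8)` ⇒ `∀ᶠ K, |Π^{(K)}(z)| ≤ C_E e^{12Mδ₁} K₀(64,8) K₁(4,δ₀∕2) e^{−δ₁|z|₁}`. -/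
theorem eventually_abs_polWindow_sum_le_torusCast (N : ℕ → ℕ) (M : ℕ) [∀ K, NeZero (N K)] [NeZero M]
    (hdvd : ∀ᶠ K in atTop, N K * M ∣ (F.P K).sitesPerDir j) (hN : Tendsto (fun K => N K * M) atTop atTop)
    (ℰ : (K : ℕ) → TDom 4 (N K) → (Fin (F.P K).d → Site (F.P K) j → 𝔄) → ℝ) (ρ : V →L[ℝ] 𝔄) (bV : Module.Basis ι ℝ V)
    (hℰ : ∀ K X, ContDiffAt ℝ 2 (expChart (ℰ K X) ρ) 0)
    {CE κ δ₀ : ℝ} (hCE : 0 ≤ CE) (hδ₀ : 0 < δ₀) (hκ : kappa₀ (4 * 2 ^ 4) (2 * 4) ≤ κ / 2)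
    (μ ν : Fin 4) (z : Fin 4 → ℤ)
    (hterm : ∀ (K : ℕ) (X : TDom 4 (N K)) (c : ι),
      let e : Site (F.P K) j → TPt 4 (N K * M) := fun x i => (ZMod.cast (x i) : ZMod (N K * M))
      |polComp ℝ (expChart (ℰ K X) ρ) bV (Fin.cast (F.P_d K).symm μ) (siteOfInt F K j z) c (Fin.cast (F.P_d K).symm ν) (siteOfInt F K j 0) c| ≤
        CE * Real.exp (-κ * torusTreeLen X.1) * Real.exp (-δ₀ * distCT (N K) M (e (siteOfInt F K j z)) (nearT (M := M) (e (siteOfInt F K j z)) X)) *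
          Real.exp (-δ₀ * distCT (N K) M (e (siteOfInt F K j 0)) (nearT (M := M) (e (siteOfInt F K j 0)) X))) :
    ∀ᶠ K in atTop, |polWindow F K j (fun U => ∑ X, ℰ K X U) ρ bV μ ν z| ≤
        CE * Real.exp (delta1 δ₀ κ ((M : ℝ) * 4) * ((M : ℝ) * 4) * 3) * K₀ (4 * 2 ^ 4) (2 * 4) * K₁ 4 (δ₀ / 2) *
          Real.exp (-(delta1 δ₀ κ ((M : ℝ) * 4) * l1 z)) := by
  have hκ0 : 0 ≤ κ := by
    have h2 : (0 : ℝ) ≤ κ / 2 := (kappa₀_nonneg (c₀ := 4 * 2 ^ 4) (by positivity) (2 * 4)).trans hκ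
    linarith
  have hMd : (0 : ℝ) < (M : ℝ) * 4 := mul_pos (Nat.cast_pos.2 (Nat.pos_of_neZero M)) (by norm_num)
  have hiso : ∀ᶠ K in atTop, l1 z - 0 ≤
      pl1 ((fun (x : Site (F.P K) j) (i : Fin (F.P K).d) => (ZMod.cast (x i) : ZMod (N K * M))) (siteOfInt F K j z) -
        (fun (x : Site (F.P K) j) (i : Fin (F.P K).d) => (ZMod.cast (x i) : ZMod (N K * M))) (siteOfInt F K j 0)) := by
    filter_upwards [hiso_cast F j N M hdvd hN z] with K hK
    rw [sub_zero]
    exact hK.symm.le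
  have h' := eventually_abs_polWindow_sum_le_comap F j (fun K => tsys 4 (N K)) (fun K => (tcubeSys 4 (N K)).toCubeCover)
    (fun K => TPt 4 (N K * M)) (fun K => geomT 4 (N K) M) (fun K x y => pl1 (x - y))
    (fun K (x : Site (F.P K) j) (i : Fin (F.P K).d) => (ZMod.cast (x i) : ZMod (N K * M)))
    ℰ ρ bV hℰ hCE (K₀_pos _ _).le (delta1_nonneg hδ₀.le hκ0 hMd) (delta1_le_half δ₀ κ _) (delta1_mul_le δ₀ κ hMd)
    (fun K => by simpa using geomLeafT 4 (N K) M) (fun K => cubeSumLeafT 4 (N K) M (half_pos hδ₀)) (fun K => treeLeafT 4 (N K) hκ) μ ν z hiso hterm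
  simp only [mul_zero, Real.exp_zero, mul_one] at h'
  exact h'

end YMDAG.N22.WindowSoftTwoPoint

end
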